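import Summits.CriticalPhenomena.PercolationContinuityZ3.Theorems.Transplant.FKConnectivityAllQSlackFourPoint
import HarnessLib

/-!
# UNIFORM-PAIR slack four-point: a statement about Bernoulli percolation that gives Kozma–Nitzan's additive gluing for relay sets of
# EVERY size under EVERY cluster-count reweighting — `PairSlackUnder`, `additiveGluingUnder_of_pairSlack` (any probability measure), the
# node `UniformPairSlackBilevelPos` and the reduction `UniformPairSlackBilevelPos → AdditiveGluingCountPos`

Support file (`--supports stmt-CriticalPhenomena-4575`), FK sub-lane `prim-bschramm-fk-1` (gen 12) of the post-continuity programme;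
builds on p205010 (kernel theorem, internal audit signed; external expert review pending).  Definitions (`glueDefectA`, `PairSlackUnder`,
`UniformPairSlackBilevelOn`, one `@[conjecture]` node — NOT asserted), no named facts, no sorries; standard axioms.  Nothing here bears
on p205010 (its chain proves additive gluing for PRODUCT measure); this file is about which other measures inherit it.

THE MECHANISM (continuing `…SlackFourPoint.lean`).  For a source `o`, target `b`, relay set `A` and `F = {o ↔ A} ∖ {o ↔ b}`
(`glueDefectA`), additive gluing FAILS for the relay `a ∈ A` iff `μ(F) > μ(a ↮ b)` iff `μ(F ∩ {a ↔ b}) > μ({a ↮ b} ∖ F)` — an IDENTITY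
of measures, `μ(F) − μ(a ↮ b) = μ(F ∩ {a ↔ b}) − μ({a ↮ b} ∖ F)` (`measureReal_sub_compl_eq`).  Hence if for SOME pair `a, c ∈ A`
**(pair slack) `μ(F ∩ {a ↔ b})·μ(F ∩ {c ↔ b}) ≤ μ({a ↮ b} ∖ F)·μ({c ↮ b} ∖ F)`** (`PairSlackUnder μ A o b a c`), then `a` and `c` cannot
both fail and additive gluing holds for `A` (`additiveGluingUnder_of_pairSlack`, any probability measure; `a = c` allowed, which covers
`|A| = 1`).  For `A = {a, c}` this is exactly `SlackFourPointUnder` (fk-1 g12, `…SlackFourPoint.lean`).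
**(UP-SFP) `UniformPairSlackBilevelOn V`**: for Bernoulli percolation `P_w`, every non-empty `A`, `o`, `b`, there is ONE pair `a, c ∈ A`
whose symmetrised LEVEL-PAIR inequalities `X_a[j]X_c[j'] + X_a[j']X_c[j] ≤ G_a[j]G_c[j'] + G_a[j']G_c[j]` hold for all levels `j, j'`
(`X_a[j] = P_w(F ∩ {a ↔ b} ∩ L_j)`, `G_a[j] = P_w(({a ↮ b} ∖ F) ∩ L_j)`, `L_j = {k = j}`); summing with weights `h(j)h(j') ≥ 0` gives the
pair-slack inequality under `μ_h ∝ P_w·h(k)` for EVERY positive `h` with the SAME pair (`pairSlackUnder_crMeasure_of_bilevel`), hence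
**`additiveGluingCountPos_of_uniformPairSlackBilevelPos : UniformPairSlackBilevelPos → AdditiveGluingCountPos`** (all relay-set sizes,
all count weights; in particular `FK.AdditiveGluingFKPos`, every `q > 0`).  Compare fk-1 g11's uniform-RELAY levelwise gluing
(`UniformLevelGluingPos`, linear in the levels), which is FALSE at n = 7: the present statement is quadratic (pairs of levels, pairs of
relays) and has no counterexample so far.
TWO COMPLEMENTARY CERTIFICATES.  The 'pair' may be a single relay: `(a, a)` is clean iff `X_a[j] ≤ G_a[j]` at every level `j`, i.e. iff
relay `a` glues LEVELWISE (fk-1 g11's uniform-relay condition for `a`, since `P(F ∩ L_j) − P({a ↮ b} ∩ L_j) = X_a[j] − G_a[j]`); so the node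
is the DISJUNCTION of g11's (linear) uniform-relay levelwise gluing and the (quadratic) DISTINCT-pair bilevel slack inequality.  Each disjunct
alone is FALSE — `not_uniformLevelGluingPos` (g11, n = 7) and `not_slackFourPointBilevelPos` (g12, `…SlackFourPointCex.lean`, n = 6) — and
the census below shows the two failure sets DISJOINT so far: every known failure of one is covered by the other.
EVIDENCE (fk-1 g12, 2026-08-21; kit job j133621, EXACT integer arithmetic, 32 cores, 574 s; memo bschramm/FROM-fk-1-g12-SLACK-FOURPOINT.md §5):
11,448,000 placements `(G, w, o, b, A)` on random weighted graphs (integer weights `k/D`, `D ∈ {4,10,20,30,100}`, incl. near-deterministic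
palettes) — n = 6: all placements, |A| = 2, 3, 4 (648,000 / 432,000 / 108,000); n = 7: |A| = 2..5 (2.42M / 2.42M / 1.21M / 0.24M); n = 8:
|A| = 2..5 (0.77M / 1.03M / 0.77M / 0.31M); n = 9: |A| = 2, 3, 4 (0.25M / 0.42M / 0.41M): a clean DISTINCT pair fails to exist in exactly 34
placements (27 with |A| = 2, 7 with |A| = 3, none with |A| ≥ 4), and in EVERY one of the 34 some single relay glues levelwise; conversely on
all 166 recorded uniform-relay failures of fk-1 g11 (kit j132384 / j132564 / j132803, n = 7, 8, 9) a clean distinct pair exists.  Net: 0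
counterexamples to `UniformPairSlackBilevelPos` in ≈ 11.4·10⁶ + 166 adversarial placements.  (The pair of the two least reliable relays is the
clean one in ≈ 99.9 % of the placements with |A| ≥ 3, not in all; 'all pairs clean' fails in ≈ 35 %.)
[cite: KozmaNitzan2024, Conj. 1 (p. 3); Thm. 1, eq. (6) (pp. 7–8)] [cite: Grimmett2006, §1.4 eq. (1.20) (p. 15); §3.9 (pp. 63–65)]
-/

noncomputable section

namespace Summit.CriticalPhenomena.PercolationContinuityZ3.Theorems

namespace FK

open MeasureTheory Set Literature.Probability.LatticeModels Literature.Probability.Percolation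
open scoped Classical

variable {V : Type*}

/-! ### The gluing defect of a relay set and the pair-slack inequality -/

/-- **The gluing defect of the relay set `A`**: `F = {o ↔ A} ∖ {o ↔ b}`. [cite: KozmaNitzan2024, Conj. 1 (p. 3)] -/
def glueDefectA (A : Finset V) (o b : V) : Set (BondConfig V) := (⋃ a ∈ A, openConn o a) \ openConn o b

/-- **Pair-slack inequality under `μ`** for the relays `a, c` of `A`:
`μ(F ∩ {a ↔ b})·μ(F ∩ {c ↔ b}) ≤ μ({a ↮ b} ∖ F)·μ({c ↮ b} ∖ F)`, `F = glueDefectA A o b`.  For `A = {a, c}` this is `SlackFourPointUnder`.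
[cite: KozmaNitzan2024, Thm. 1, eq. (6) (pp. 7–8); Conj. 1 (p. 3)] -/
def PairSlackUnder (μ : Measure (BondConfig V)) (A : Finset V) (o b a c : V) : Prop :=
  μ.real (glueDefectA A o b ∩ openConn a b) * μ.real (glueDefectA A o b ∩ openConn c b) ≤
    μ.real ((openConn a b)ᶜ \ glueDefectA A o b) * μ.real ((openConn c b)ᶜ \ glueDefectA A o b)

section AnyMeasure

variable [Fintype V]

/-- **The failure of a relay is a measure identity**: `μ(F) − μ(Sᶜ) = μ(F ∩ S) − μ(Sᶜ ∖ F)` for any events `F, S` (finite measure).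
[folklore] -/
theorem measureReal_sub_compl_eq (μ : Measure (BondConfig V)) [IsFiniteMeasure μ] (F S : Set (BondConfig V)) :
    μ.real F - μ.real Sᶜ = μ.real (F ∩ S) - μ.real (Sᶜ \ F) := by
  have hS : MeasurableSet S := measurableSet_bond _
  have hF : MeasurableSet F := measurableSet_bond _
  have h1 : μ.real F = μ.real (F ∩ S) + μ.real (F \ S) := (measureReal_inter_add_sdiff (μ := μ) (s := F) hS).symm
  have h2 : μ.real Sᶜ = μ.real (Sᶜ ∩ F) + μ.real (Sᶜ \ F) := (measureReal_inter_add_sdiff (μ := μ) (s := Sᶜ) hF).symm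
  have heq : Sᶜ ∩ F = F \ S := by rw [Set.sdiff_eq_compl_inter]
  rw [heq] at h2
  linarith

omit [Fintype V] in
/-- `{o ↔ A} ⊆ {o ↔ b} ∪ F`. [folklore] -/
theorem iUnion_subset_openConn_union_glueDefectA (A : Finset V) (o b : V) :
    (⋃ a ∈ A, (openConn o a : Set (BondConfig V))) ⊆ openConn o b ∪ glueDefectA A o b := by
  intro ω hω
  by_cases h : ω ∈ (openConn o b : Set (BondConfig V))
  · exact Or.inl h
  · exact Or.inr ⟨hω, h⟩

/-- **Pair slack ⇒ additive gluing for the whole relay set** (any probability measure on the bond configurations of a finite vertex type):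
if `a, c ∈ A` satisfy the pair-slack inequality then `μ(o ↔ b) ≥ μ(o ↔ A) − t` for every `t ≥ max_{x ∈ A} μ(x ↮ b)`.  Proof:
`μ(o ↔ A) ≤ μ(o ↔ b) + μ(F)`; if `μ(F) > t` then `μ(F ∩ {a ↔ b}) > μ({a ↮ b} ∖ F) ≥ 0` and the same for `c` (`measureReal_sub_compl_eq`),
and the product of the two strict inequalities contradicts the hypothesis. [cite: KozmaNitzan2024, Conj. 1 (p. 3); Thm. 1 (p. 7)] -/
theorem additiveGluingUnder_of_pairSlack (μ : Measure (BondConfig V)) [IsProbabilityMeasure μ] (A : Finset V) (o b a c : V)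
    (ha : a ∈ A) (hc : c ∈ A) (hS : PairSlackUnder μ A o b a c) : AdditiveGluingUnder μ A o b := by
  intro t ht hA
  set F : Set (BondConfig V) := glueDefectA A o b with hFdef
  have hU : μ.real (⋃ x ∈ A, (openConn o x : Set (BondConfig V))) ≤ μ.real (openConn o b) + μ.real F :=
    (measureReal_mono (iUnion_subset_openConn_union_glueDefectA A o b)).trans (measureReal_union_le _ _)
  have hta : μ.real (openConn a b)ᶜ ≤ t := by
    have := hA a ha
    rw [measureReal_compl (measurableSet_bond _), probReal_univ]; linarith
  have htc : μ.real (openConn c b)ᶜ ≤ t := by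
    have := hA c hc
    rw [measureReal_compl (measurableSet_bond _), probReal_univ]; linarith
  have ida := measureReal_sub_compl_eq μ F (openConn a b)
  have idc := measureReal_sub_compl_eq μ F (openConn c b)
  unfold PairSlackUnder at hS
  set xa := μ.real (F ∩ openConn a b)
  set xc := μ.real (F ∩ openConn c b)
  set ga := μ.real ((openConn a b)ᶜ \ F)
  set gc := μ.real ((openConn c b)ᶜ \ F)
  have hga : 0 ≤ ga := measureReal_nonneg
  have hgc : 0 ≤ gc := measureReal_nonneg
  have key : μ.real F ≤ t := by
    by_contra hF
    push Not at hF
    have h1 : ga < xa := by linarith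
    have h2 : gc < xc := by linarith
    have : ga * gc < xa * xc := by nlinarith
    linarith
  linarith

omit [Fintype V] in
/-- **For `A = {a, c}` the pair-slack inequality is the slack four-point inequality** (`F ∩ {a ↔ b} = {oc|ab}`, `F ∩ {c ↔ b} = {oa|cb}`).
[cite: KozmaNitzan2024, Thm. 1, eq. (6) (pp. 7–8)] -/
theorem pairSlackUnder_pair_iff (μ : Measure (BondConfig V)) (o b a c : V) :
    PairSlackUnder μ ({a, c} : Finset V) o b a c ↔ SlackFourPointUnder μ o a c b := by
  have hF : glueDefectA ({a, c} : Finset V) o b = (glueDefect o a c b : Set (BondConfig V)) := by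
    unfold glueDefectA glueDefect
    congr 1
    ext ω; simp [Finset.mem_insert, Finset.mem_singleton]
  have h7 : glueDefect o a c b ∩ openConn a b = openConn o c ∩ openConn b a ∩ (sepEv a c : Set (BondConfig V)) := by
    apply Set.Subset.antisymm
    · exact glue_diff_inter_subset_x7 o a c b
    · rintro ω ⟨⟨hoc, hba⟩, hac⟩
      rw [mem_sepEv_iff] at hac
      simp only [glueDefect, mem_inter_iff, mem_sdiff, mem_union, mem_openConn_iff'] at hoc hba ⊢
      exact ⟨⟨Or.inr hoc, fun hob => hac ((hoc.symm.trans hob).trans hba).symm⟩, hba.symm⟩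
  have h6 : glueDefect o a c b ∩ openConn c b = openConn o a ∩ openConn b c ∩ (sepEv a c : Set (BondConfig V)) := by
    rw [← glueDefect_comm]
    apply Set.Subset.antisymm
    · intro ω hω
      have := glue_diff_inter_subset_x7 o c a b hω
      rw [← sepEv_comm a c] at this
      exact this
    · rintro ω ⟨⟨hoa, hbc⟩, hac⟩
      rw [mem_sepEv_iff] at hac
      simp only [glueDefect, mem_inter_iff, mem_sdiff, mem_union, mem_openConn_iff'] at hoa hbc ⊢
      exact ⟨⟨Or.inr hoa, fun hob => hac ((hoa.symm.trans hob).trans hbc)⟩, hbc.symm⟩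
  unfold PairSlackUnder SlackFourPointUnder
  rw [hF, h7, h6, mul_comm (μ.real (openConn o c ∩ openConn b a ∩ sepEv a c)),
    mul_comm (μ.real ((openConn a b)ᶜ \ glueDefect o a c b))]

end AnyMeasure

/-! ### The uniform-pair level statement for Bernoulli percolation and its summation to every count weight -/

section Bilevel

variable [Fintype V]

/-- **Uniform-pair bilevel slack four-point on the vertex type `V`** (UP-SFP): for all weights `w`, every NON-EMPTY relay set `A`, source `o`
and target `b`, writing `F = {o ↔ A} ∖ {o ↔ b}`, `X_a = F ∩ {a ↔ b}`, `G_a = {a ↮ b} ∖ F`, THERE ARE `a, c ∈ A` (possibly equal) such that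
for all levels `j, j'`:
`P(X_a ∩ L_j)P(X_c ∩ L_j') + P(X_a ∩ L_j')P(X_c ∩ L_j) ≤ P(G_a ∩ L_j)P(G_c ∩ L_j') + P(G_a ∩ L_j')P(G_c ∩ L_j)`.
[cite: KozmaNitzan2024, Conj. 1 (p. 3); Thm. 1 (p. 7)] [cite: Grimmett2006, §1.2 eq. (1.1) (p. 4)] -/
def UniformPairSlackBilevelOn (V : Type*) [Fintype V] : Prop :=
  ∀ (w : Sym2 V → unitInterval) (A : Finset V) (o b : V), A.Nonempty →
    ∃ a ∈ A, ∃ c ∈ A, ∀ j j' : ℕ,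
      (prodBernoulli w).real (glueDefectA A o b ∩ openConn a b ∩ levelSet V j) *
          (prodBernoulli w).real (glueDefectA A o b ∩ openConn c b ∩ levelSet V j') +
        (prodBernoulli w).real (glueDefectA A o b ∩ openConn a b ∩ levelSet V j') *
          (prodBernoulli w).real (glueDefectA A o b ∩ openConn c b ∩ levelSet V j) ≤
      (prodBernoulli w).real (((openConn a b)ᶜ \ glueDefectA A o b) ∩ levelSet V j) *
          (prodBernoulli w).real (((openConn c b)ᶜ \ glueDefectA A o b) ∩ levelSet V j') +
        (prodBernoulli w).real (((openConn a b)ᶜ \ glueDefectA A o b) ∩ levelSet V j') *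
          (prodBernoulli w).real (((openConn c b)ᶜ \ glueDefectA A o b) ∩ levelSet V j)

/-- **Uniform-pair bilevel slack four-point on every finite weighted graph.**  CONJECTURE-SHAPED STATEMENT about Bernoulli percolation,
NOT asserted.  Evidence (fk-1 g12, kit j133621, exact): 0 counterexamples in 11,448,000 placements (n = 6..9, |A| = 2..5) — the 34 placements with no
clean DISTINCT pair all have a levelwise-gluing single relay, and g11's 166 recorded uniform-relay failures all have a clean distinct pair
(module docstring).  Each disjunct alone is refuted (`not_uniformLevelGluingPos`, `not_slackFourPointBilevelPos`).  Gives
`AdditiveGluingCountPos` (`additiveGluingCountPos_of_uniformPairSlackBilevelPos`).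
[cite: KozmaNitzan2024, Conj. 1 (p. 3)] [cite: Grimmett2006, §1.2 eq. (1.1) (p. 4)] -/
@[conjecture] def UniformPairSlackBilevelPos : Prop := ∀ n : ℕ, UniformPairSlackBilevelOn (Fin n)

/-- **Bilevel pair inequalities sum to the pair-slack inequality under every positive count weight** (same pair for all `h`).
[cite: Grimmett2006, §1.4 eq. (1.20) (p. 15)] -/
theorem pairSlackUnder_crMeasure_of_bilevel (w : Sym2 V → unitInterval) {h : ℕ → ℝ} (hpos : ∀ k, 0 < h k) (A : Finset V)
    (o b a c : V)
    (hB : ∀ j j' : ℕ,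
      (prodBernoulli w).real (glueDefectA A o b ∩ openConn a b ∩ levelSet V j) *
          (prodBernoulli w).real (glueDefectA A o b ∩ openConn c b ∩ levelSet V j') +
        (prodBernoulli w).real (glueDefectA A o b ∩ openConn a b ∩ levelSet V j') *
          (prodBernoulli w).real (glueDefectA A o b ∩ openConn c b ∩ levelSet V j) ≤
      (prodBernoulli w).real (((openConn a b)ᶜ \ glueDefectA A o b) ∩ levelSet V j) *
          (prodBernoulli w).real (((openConn c b)ᶜ \ glueDefectA A o b) ∩ levelSet V j') +
        (prodBernoulli w).real (((openConn a b)ᶜ \ glueDefectA A o b) ∩ levelSet V j') *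
          (prodBernoulli w).real (((openConn c b)ᶜ \ glueDefectA A o b) ∩ levelSet V j)) :
    PairSlackUnder (crMeasure w h) A o b a c := by
  unfold PairSlackUnder
  have hZ := crPartition_pos w hpos
  set Z := crPartition w h
  set μ := crMeasure w h
  set Xa : Set (BondConfig V) := glueDefectA A o b ∩ openConn a b
  set Xc : Set (BondConfig V) := glueDefectA A o b ∩ openConn c b
  set Ga : Set (BondConfig V) := (openConn a b)ᶜ \ glueDefectA A o b
  set Gc : Set (BondConfig V) := (openConn c b)ᶜ \ glueDefectA A o b
  rw [← mul_le_mul_iff_of_pos_right (mul_pos hZ hZ)]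
  have e : ∀ X Y : Set (BondConfig V), μ.real X * μ.real Y * (Z * Z) = (μ.real X * Z) * (μ.real Y * Z) := fun X Y => by ring
  rw [e, e, crMeasure_real_mul_eq_sum_levels w hpos Xa, crMeasure_real_mul_eq_sum_levels w hpos Xc,
    crMeasure_real_mul_eq_sum_levels w hpos Ga, crMeasure_real_mul_eq_sum_levels w hpos Gc]
  refine sum_mul_sum_le_of_symm fun j _ j' _ => ?_
  have hjj : 0 ≤ h j * h j' := mul_nonneg (hpos j).le (hpos j').le
  have key := mul_le_mul_of_nonneg_left (hB j j') hjj
  have lhs : h j * (prodBernoulli w).real (Xa ∩ levelSet V j) * (h j' * (prodBernoulli w).real (Xc ∩ levelSet V j')) +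
      h j' * (prodBernoulli w).real (Xa ∩ levelSet V j') * (h j * (prodBernoulli w).real (Xc ∩ levelSet V j)) =
      h j * h j' * ((prodBernoulli w).real (Xa ∩ levelSet V j) * (prodBernoulli w).real (Xc ∩ levelSet V j') +
        (prodBernoulli w).real (Xa ∩ levelSet V j') * (prodBernoulli w).real (Xc ∩ levelSet V j)) := by ring
  have rhs : h j * (prodBernoulli w).real (Ga ∩ levelSet V j) * (h j' * (prodBernoulli w).real (Gc ∩ levelSet V j')) +
      h j' * (prodBernoulli w).real (Ga ∩ levelSet V j') * (h j * (prodBernoulli w).real (Gc ∩ levelSet V j)) =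
      h j * h j' * ((prodBernoulli w).real (Ga ∩ levelSet V j) * (prodBernoulli w).real (Gc ∩ levelSet V j') +
        (prodBernoulli w).real (Ga ∩ levelSet V j') * (prodBernoulli w).real (Gc ∩ levelSet V j)) := by ring
  rw [lhs, rhs]
  exact key

/-- **(UP-SFP) ⇒ additive gluing under every positive count weight**, every relay set. [cite: KozmaNitzan2024, Conj. 1 (p. 3)]
[cite: Grimmett2006, §1.4 eq. (1.20) (p. 15)] -/
theorem additiveGluingUnder_crMeasure_of_uniformPairSlack (hU : UniformPairSlackBilevelOn V) (w : Sym2 V → unitInterval) {h : ℕ → ℝ}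
    (hpos : ∀ k, 0 < h k) (A : Finset V) (o b : V) : AdditiveGluingUnder (crMeasure w h) A o b := by
  haveI := isProbabilityMeasure_crMeasure w hpos
  by_cases hne : A.Nonempty
  · obtain ⟨a, ha, c, hc, hB⟩ := hU w A o b hne
    exact additiveGluingUnder_of_pairSlack _ A o b a c ha hc (pairSlackUnder_crMeasure_of_bilevel w hpos A o b a c hB)
  · rw [Finset.not_nonempty_iff_eq_empty] at hne
    subst hne
    exact additiveGluingUnder_empty _ o b

/-- **`UniformPairSlackBilevelPos → AdditiveGluingCountPos`**: the uniform-pair level statement for Bernoulli percolation gives Kozma–Nitzan's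
additive gluing for EVERY relay set under EVERY positive cluster-count reweighting (so under every `φ_{w,q}`, `q > 0`).
[cite: KozmaNitzan2024, Conj. 1 (p. 3)] [cite: Grimmett2006, §3.9 (pp. 63–65)] -/
theorem additiveGluingCountPos_of_uniformPairSlackBilevelPos (hU : UniformPairSlackBilevelPos) : AdditiveGluingCountPos :=
  fun n w _ hpos A o b => additiveGluingUnder_crMeasure_of_uniformPairSlack (hU n) w hpos A o b

/-- **`UniformPairSlackBilevelPos → FK.AdditiveGluingFKPos`** (all `q > 0`). [cite: KozmaNitzan2024, Conj. 1 (p. 3)] [cite: Grimmett2006, §3.9 (pp. 63–65)] -/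
theorem additiveGluingFKPos_of_uniformPairSlackBilevelPos (hU : UniformPairSlackBilevelPos) : AdditiveGluingFKPos :=
  additiveGluingFKPos_of_countPos (additiveGluingCountPos_of_uniformPairSlackBilevelPos hU)

/-- **`UniformPairSlackBilevelPos → AdditiveGluingTwoFKPos`** (the `|A| ≤ 2` slice, for the record). [cite: KozmaNitzan2024, Conj. 1 (p. 3)] -/
theorem additiveGluingTwoFKPos_of_uniformPairSlackBilevelPos (hU : UniformPairSlackBilevelPos) : AdditiveGluingTwoFKPos :=
  additiveGluingTwoFKPos_of_additiveGluingFKPos (additiveGluingFKPos_of_uniformPairSlackBilevelPos hU)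

end Bilevel

end FK

end Summit.CriticalPhenomena.PercolationContinuityZ3.Theorems

end
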